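import Summits.Ventures.PercRepro.Night2LocalAllLayerZero

/-!
# PercRepro — the diagonal shadow form needs the local form only at the FAT flats `2 ≤ |E ∖ G| ≤ q` (night-2, gen 9)

A rank-`(q+1)` flat `G` with `|E ∖ G| = 1` exists only when the missing element `w` is a coloop of `M`
(`w ∉ cl(E ∖ w) = G`).  But a matroid of rank `q + 2` with a coloop `w` satisfies the diagonal shadow
condition outright: `w` lies in no member's closure (a member `B` avoids `w`, since `E ∖ B` has rank
`q + 2 > ρ(E ∖ w)`, and `cl B ⊆ cl(E ∖ w) ∌ w`), so the e-lemma `shadow_card_of_notMem_closure` applies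
to every family.  Hence (`shadowHall_of_local_fat`): for a matroid of rank `q + 2`, the local form at the
flats with `2 ≤ |E ∖ G| ≤ q` alone gives `ShadowHall M (q+2) q Φ` — the flats with `|E ∖ G| ≥ q + 1` are
thin (`localShadowHall_of_thin`), `|E ∖ G| = 0` is impossible at rank `q + 2`, and `|E ∖ G| = 1` forces a
coloop.  Consequently the regime `|E ∖ G| = 1` of NIGHT-2-local.md (§18, INJ-d1) is not needed for the
diagonal of C-025; at `q = 3` the diagonal shadow form `ShadowHall M 5 3 Φ` now rests on the rank-`4` flats
with `|E ∖ G| = 2` only (`shadowHall_five_three_of_two`), `|E ∖ G| = 3` being `localShadowHall_dq_of_q_le_three`.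
-/

namespace PercRepro.Shadow

open Finset PerFlat ThmH

variable {α : Type*} [DecidableEq α] {M : Matroid α} [M.Finite]

omit [DecidableEq α] in
/-- A flat is its own finset closure. -/
theorem clF_eq_self_of_mem_flatsQ {q : ℕ} {G : Finset α} (hG : G ∈ flatsQ M q) : clF M G = G := by
  rw [← Finset.coe_inj, coe_clF]
  exact (mem_flatsQ.1 hG).2.1.closure

open scoped Classical in
/-- **A coloop settles the diagonal shadow form**: if `M` has rank `q + 2` and a coloop `w`, then
`ShadowHall M (q+2) q Φ` (the e-lemma with `e = w`). -/
theorem shadowHall_of_coloop {q : ℕ} (hrk : M.eRk ((gr M : Finset α) : Set α) = ((q + 2 : ℕ) : ℕ∞))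
    {w : α} (hw : w ∈ gr M) (hwcl : w ∉ clF M ((gr M).erase w)) :
    ShadowHall M (q + 2) q (((q : ℚ) + 2) / ((q : ℚ) + 1)) := by
  intro 𝒜 h𝒜
  have hrank : M.eRk (((gr M).erase w : Finset α) : Set α) = ((q + 1 : ℕ) : ℕ∞) := by
    have h1 := eRk_insert_of_notMem_clF_erase (G := gr M) (Finset.Subset.refl _) hw hwcl
      (X := (gr M).erase w) le_rfl
    rw [Finset.insert_erase hw, hrk] at h1
    have h2 : ((q + 1 : ℕ) : ℕ∞) + 1 = M.eRk (((gr M).erase w : Finset α) : Set α) + 1 := by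
      rw [← h1]; push_cast; rfl
    exact (WithTop.add_right_cancel ENat.one_ne_top h2).symm
  have key : ∀ B ∈ 𝒜, w ∉ clF M B := by
    intro B hB hwB
    have hBU := h𝒜 hB
    rw [mem_Uq] at hBU
    obtain ⟨hBg, -, hBc⟩ := hBU
    by_cases hwB' : w ∈ B
    · have hsub : gr M \ B ⊆ (gr M).erase w := by
        intro e he
        rw [Finset.mem_sdiff] at he
        rw [Finset.mem_erase]
        exact ⟨fun h => he.2 (h ▸ hwB'), he.1⟩
      have h := M.eRk_mono (by exact_mod_cast hsub : ((gr M \ B : Finset α) : Set α) ⊆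
        (((gr M).erase w : Finset α) : Set α))
      rw [hBc, hrank] at h
      have : q + 2 ≤ q + 1 := by exact_mod_cast h
      omega
    · apply hwcl
      have hBe : B ⊆ (gr M).erase w := by
        intro e he
        rw [Finset.mem_erase]
        exact ⟨fun h => hwB' (h ▸ he), hBg he⟩
      exact clF_mono hBe hwB
  exact shadow_card_of_notMem_closure h𝒜 hw key

open scoped Classical in
/-- **Only the fat flats matter**: for a matroid of rank `q + 2`, the local form at the rank-`(q+1)` flats
`G` with `2 ≤ |E ∖ G| ≤ q` gives the diagonal shadow form. -/
theorem shadowHall_of_local_fat {q : ℕ} (hrk : M.eRk ((gr M : Finset α) : Set α) = ((q + 2 : ℕ) : ℕ∞))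
    (hloc : ∀ G ∈ flatsQ M (q + 1), 2 ≤ (gr M \ G).card → (gr M \ G).card ≤ q → LocalShadowHall M q G) :
    ShadowHall M (q + 2) q (((q : ℚ) + 2) / ((q : ℚ) + 1)) := by
  by_cases hcol : ∃ w ∈ gr M, w ∉ clF M ((gr M).erase w)
  · obtain ⟨w, hw, hwcl⟩ := hcol
    exact shadowHall_of_coloop hrk hw hwcl
  · push Not at hcol
    apply shadowHall_of_local
    intro G hG
    have hGg : G ⊆ gr M := (mem_flatsQ.1 hG).1
    have hGr : M.eRk (G : Set α) = ((q + 1 : ℕ) : ℕ∞) := (mem_flatsQ.1 hG).2.2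
    rcases Nat.lt_or_ge (gr M \ G).card 2 with hlt | hge
    · -- `|E ∖ G| ∈ {0, 1}`: impossible without a coloop at rank `q + 2`
      exfalso
      rcases Nat.lt_or_ge (gr M \ G).card 1 with h0 | h1
      · -- `G = E`, but `ρ(G) = q + 1 ≠ q + 2`
        have hempty : gr M \ G = ∅ := Finset.card_eq_zero.1 (by omega)
        rw [Finset.sdiff_eq_empty_iff_subset] at hempty
        have : G = gr M := le_antisymm hGg hempty
        rw [this, hrk] at hGr
        have : q + 2 = q + 1 := by exact_mod_cast hGr
        omega
      · -- `E ∖ G = {w}`: then `E ∖ w = G` and `w ∈ cl G = G`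
        have hone : (gr M \ G).card = 1 := by omega
        obtain ⟨w, hwG⟩ := Finset.card_eq_one.1 hone
        have hw : w ∈ gr M := (Finset.mem_sdiff.1 (hwG ▸ Finset.mem_singleton_self w)).1
        have hwG' : w ∉ G := (Finset.mem_sdiff.1 (hwG ▸ Finset.mem_singleton_self w)).2
        have hGe : (gr M).erase w = G := by
          ext e
          rw [Finset.mem_erase]
          constructor
          · rintro ⟨hew, heg⟩
            by_contra heG
            have : e ∈ gr M \ G := Finset.mem_sdiff.2 ⟨heg, heG⟩
            rw [hwG, Finset.mem_singleton] at this
            exact hew this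
          · intro heG
            exact ⟨fun h => hwG' (h ▸ heG), hGg heG⟩
        have := hcol w hw
        rw [hGe, clF_eq_self_of_mem_flatsQ hG] at this
        exact hwG' this
    · rcases Nat.lt_or_ge q (gr M \ G).card with hbig | hle
      · -- thin: every member below `G` has `|E ∖ cl B| ≥ q + 2`
        apply localShadowHall_of_thin hG
        intro B hB hBG
        have h := card_compl_clF_add hG hBG
        have h1 := one_le_card_sdiff_clF hG hB
        omega
      · exact hloc G hG hge hle

open scoped Classical in
/-- **The diagonal shadow form at `q = 3` rests on the rank-`4` flats with `|E ∖ G| = 2`**: for a matroid of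
rank `5`, the local form at those flats gives `ShadowHall M 5 3 Φ` (`|E ∖ G| = 3` is
`localShadowHall_dq_of_q_le_three`). -/
theorem shadowHall_five_three_of_two (hrk : M.eRk ((gr M : Finset α) : Set α) = ((5 : ℕ) : ℕ∞))
    (hloc : ∀ G ∈ flatsQ M 4, (gr M \ G).card = 2 → LocalShadowHall M 3 G) :
    ShadowHall M 5 3 (((3 : ℕ) + 2 : ℚ) / ((3 : ℕ) + 1 : ℚ)) := by
  apply shadowHall_of_local_fat (q := 3) hrk
  intro G hG h2 h3
  rcases Nat.lt_or_ge (gr M \ G).card 3 with hlt | hge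
  · exact hloc G hG (by omega)
  · exact localShadowHall_dq_of_q_le_three (by norm_num) hG (by omega)

end PercRepro.Shadow
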